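/-
Fleet lead `ym-wcr-19609-p1` (seat prover-ym-wcr-19609-p1-g2-0), route `WeakCouplingRates`, crux `BulkDominatesColdBoxW`
(stmt-QuantumFields-19609), line `dlr-chessboard` (v6): the kernel only reads the collar of the datum (bridge to `…DatumCompetitor`).
-/
import Summits.QuantumFields.YangMills.Theorems.WeakCouplingRatesColdBoxChartPlaquette
import Literature.MathematicalPhysics.QuantumLattice.LatticeGaugeDLRGibbsProofs

/-!
# Crux `BulkDominatesColdBoxW`: the DLR kernel `γ_Λ(·|η)` integrates a `Λ`-local observable identically for two data that agree on the
# edges of the plaquettes touching `Λ` (truncating a datum far from the box changes nothing)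

`integral_ymSpecification_congr_collar`: if `η = η'` on every edge, outside `Λ`, of every plaquette touching `Λ`, and `F` reads the glued
configuration identically for `η` and `η'` (e.g. `F` depends only on `Λ`-links), then `∫ F dγ_Λ(·|η) = ∫ F dγ_Λ(·|η')`.  With
`η' =` the truncated gauge copy of `…DatumCompetitor` this bridges the interface's `boxKernel β H ω` to the configuration whose gnomonic
coordinates carry the energy bound.  No new definition; standard axioms.  NOT a claim about the mass gap.
-/

set_option autoImplicit false

noncomputable section

open MeasureTheory Finset
open Literature.Probability.LatticeModels Literature.MathematicalPhysics.QuantumLattice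
open Literature.MathematicalPhysics.QuantumFieldTheory

namespace Summit.QuantumFields.YangMills.Theorems.WeakCouplingRates

variable {d N : ℕ} {G : Type*} [Group G] [TopologicalSpace G] [IsTopologicalGroup G] [CompactSpace G]
  [MeasurableSpace G] [BorelSpace G] [SecondCountableTopology G] (ρ : G →* Matrix (Fin N) (Fin N) ℂ)

omit [TopologicalSpace G] [IsTopologicalGroup G] [CompactSpace G] [MeasurableSpace G] [BorelSpace G] [SecondCountableTopology G] in
/-- The boundary Wilson action of `Λ` reads a configuration only on the edges of the plaquettes touching `Λ`. -/
theorem wilsonBoundaryAction_congr (Λ : Finset (Literature.MathematicalPhysics.QuantumLattice.ZdEdge d)) {U U' : LGConfig d G}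
    (h : ∀ p ∈ plaquettesTouching Λ, ∀ e ∈ plaquetteEdges p, U e = U' e) :
    wilsonBoundaryAction ρ Λ U = wilsonBoundaryAction ρ Λ U' := by
  unfold wilsonBoundaryAction
  refine Finset.sum_congr rfl fun p hp => ?_
  have h1 := h p hp (p.1, p.2.1.1) (by simp [plaquetteEdges])
  have h2 := h p hp (p.1 + Pi.single p.2.1.1 1, p.2.1.2) (by simp [plaquetteEdges])
  have h3 := h p hp (p.1 + Pi.single p.2.1.2 1, p.2.1.1) (by simp [plaquetteEdges])
  have h4 := h p hp (p.1, p.2.1.2) (by simp [plaquetteEdges])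
  simp only [plaquetteObs, plaquetteHolonomyZd, h1, h2, h3, h4]

/-- **The kernel reads the datum only on the collar.**  If `η = η'` on every edge outside `Λ` of every plaquette touching `Λ`, and the
observable `F` reads the glued configurations identically, then `∫ F dγ_Λ(·|η) = ∫ F dγ_Λ(·|η')`. -/
theorem integral_ymSpecification_congr_collar (hρ : Continuous ρ) (β : ℝ) (Λ : Finset (Literature.MathematicalPhysics.QuantumLattice.ZdEdge d)) {η η' : LGConfig d G}
    (hη : ∀ p ∈ plaquettesTouching Λ, ∀ e ∈ plaquetteEdges p, e ∉ Λ → η e = η' e)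
    {F : LGConfig d G → ℝ} (hF : Measurable F) (hFη : ∀ ζ : ↥Λ → G, F (glueWith Λ ζ η) = F (glueWith Λ ζ η')) :
    ∫ U, F U ∂(ymSpecification ρ β Λ η) = ∫ U, F U ∂(ymSpecification ρ β Λ η') := by
  have hS : ∀ ζ : ↥Λ → G, wilsonBoundaryAction ρ Λ (glueWith Λ ζ η) = wilsonBoundaryAction ρ Λ (glueWith Λ ζ η') := by
    intro ζ
    refine wilsonBoundaryAction_congr ρ Λ fun p hp e he => ?_
    by_cases heΛ : e ∈ Λ
    · rw [glueWith_apply_mem _ _ _ heΛ, glueWith_apply_mem _ _ _ heΛ]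
    · rw [glueWith_apply_not_mem _ _ _ heΛ, glueWith_apply_not_mem _ _ _ heΛ, hη p hp e he heΛ]
  rw [integral_ymSpecification ρ hρ β Λ hF η, integral_ymSpecification ρ hρ β Λ hF η']
  simp only [hFη, hS]

end Summit.QuantumFields.YangMills.Theorems.WeakCouplingRates

end
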